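import Mathlib
import HarnessLib
import Literature.Computability.AlgebraicComplexity.BDS24ExponentialInterpolation
import Literature.Computability.AlgebraicComplexity.ValiantClassesProofs
import Literature.Computability.AlgebraicComplexity.ArithCircuitProofs

/-!
# Route MonotoneRestoration — aside `OrbitCompressionQP` (stmt-ValiantsHypothesis-18332), line
# `expression_compression`: COEFFICIENT SLICES of a polynomial in one pinned variable

Toolkit for the pinned-entry strata of `stub_narrowExpressionCompression` (next file
`…PinnedEntryRow.lean`: the 2-row stratum for inner polynomials AFFINE in the second row).  For
`H ∈ ℂ[t, x_σ]` (variable type `Option σ`, `none = t`) with `deg_t H ≤ D`: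

* `optionEquivLeft_rename_some`, `eq_sum_X_pow_mul_rename_coeffEps` — the slice decomposition
  `H = Σ_{d ≤ D} t^d · H_d(x)`, `H_d = coeffEps d H` (the tree's `coeffEps`, BDS24 file);
* `optionEquivLeft_rename_optionMap`, `coeffEps_rename_optionMap`, `isSymmetric_coeffEps` — slicing
  commutes with renaming the `x`-variables; the slices of an `x`-symmetric `H` are symmetric;
* `complexity_epsEval_le`, ★ `complexity_coeffEps_le` — **slices are cheap**:
  `L(H_d) ≤ (D+1)(L(H)+2) + 1`, by the tree's root-of-unity interpolation `sum_epsEval_rootOfUnity`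
  (`Σ_i ω^{(N-d)i} H(ω^i, x) = N · H_d`, `ω` a primitive `N = D+1`-st root of unity in `ℂ`) — each
  evaluation `H(ω^i, x)` is a projection of `H`;
* `totalDegree_coeffEps_le` — `deg H_d ≤ deg H` (Mathlib).

Helper file (`--supports stmt-ValiantsHypothesis-18332`); def-free; nothing here is a named fact; no
registered stub is closed; VP ≠ VNP is not moved.
-/

noncomputable section

open MvPolynomial

-- `Summit.ValiantsHypothesis.ValiantsHypothesis.…` is the tree's single-conjunct layout (Sub = Summit).
set_option linter.dupNamespace false

namespace Summit.ValiantsHypothesis.ValiantsHypothesis.Theorems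

namespace CoefficientSlices

open Literature.Computability.AlgebraicComplexity

variable {σ : Type*}

/-! ### The slice decomposition -/

/-- `optionEquivLeft` sends an `x`-only polynomial to a constant of `ℂ[x][t]`. [folklore] -/
theorem optionEquivLeft_rename_some (q : MvPolynomial σ ℂ) :
    optionEquivLeft ℂ σ (rename some q) = Polynomial.C q := by
  induction q using MvPolynomial.induction_on with
  | C a => simp [optionEquivLeft_C]
  | add p q hp hq => simp [hp, hq]
  | mul_X p j hp => simp [hp, rename_X, optionEquivLeft_X_some]

/-- **Slice decomposition**: `H = Σ_{d ≤ D} t^d · (coeffEps d H)(x)` when `deg_t H ≤ D`. [folklore] -/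
theorem eq_sum_X_pow_mul_rename_coeffEps (H : MvPolynomial (Option σ) ℂ) {D : ℕ}
    (hD : H.degreeOf none ≤ D) :
    H = ∑ d ∈ Finset.range (D + 1), X none ^ d * rename some (coeffEps d H) := by
  apply (optionEquivLeft ℂ σ).injective
  rw [map_sum]
  have hdeg : (optionEquivLeft ℂ σ H).natDegree < D + 1 := by
    rw [natDegree_optionEquivLeft]; omega
  conv_lhs => rw [(optionEquivLeft ℂ σ H).as_sum_range' (D + 1) hdeg]
  refine Finset.sum_congr rfl fun d _ => ?_
  rw [map_mul, map_pow, optionEquivLeft_X_none, optionEquivLeft_rename_some,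
    ← Polynomial.C_mul_X_pow_eq_monomial, mul_comm]
  rfl

/-! ### Slicing commutes with renaming the `x`-variables -/

/-- `optionEquivLeft (rename (Option.map τ) H) = map (rename τ) (optionEquivLeft H)`. [folklore] -/
theorem optionEquivLeft_rename_optionMap {σ' : Type*} (τ : σ → σ') (H : MvPolynomial (Option σ) ℂ) :
    optionEquivLeft ℂ σ' (rename (Option.map τ) H) =
      Polynomial.map (rename τ : MvPolynomial σ ℂ →ₐ[ℂ] MvPolynomial σ' ℂ).toRingHom
        (optionEquivLeft ℂ σ H) := by
  induction H using MvPolynomial.induction_on with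
  | C a => simp [optionEquivLeft_C]
  | add p q hp hq => simp only [map_add, hp, hq, Polynomial.map_add]
  | mul_X p o hp =>
    rw [map_mul, rename_X, map_mul, hp, map_mul, Polynomial.map_mul]
    cases o with
    | none => simp [optionEquivLeft_X_none]
    | some j => simp [optionEquivLeft_X_some, rename_X]

/-- **Slices commute with renaming**: `coeffEps d (rename (Option.map τ) H) = rename τ (coeffEps d H)`.
[folklore] -/
theorem coeffEps_rename_optionMap {σ' : Type*} (τ : σ → σ') (H : MvPolynomial (Option σ) ℂ) (d : ℕ) :
    coeffEps d (rename (Option.map τ) H) = rename τ (coeffEps d H) := by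
  unfold coeffEps
  rw [optionEquivLeft_rename_optionMap, Polynomial.coeff_map]
  rfl

/-- **The slices of an `x`-symmetric polynomial are symmetric.** [folklore] -/
theorem isSymmetric_coeffEps (H : MvPolynomial (Option σ) ℂ)
    (hH : ∀ τ : Equiv.Perm σ, rename (Option.map τ) H = H) (d : ℕ) :
    (coeffEps d H).IsSymmetric := by
  intro τ
  rw [← coeffEps_rename_optionMap, hH]

/-! ### Slices are cheap -/

/-- Evaluating the pinned variable at a scalar is a projection: `L(H(c, x)) ≤ L(H)`. [folklore] -/
theorem complexity_epsEval_le (c : ℂ) (H : MvPolynomial (Option σ) ℂ) :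
    complexity (epsEval c H) ≤ complexity H :=
  complexity_le_of_isProjection ⟨fun o : Option σ => o.elim (C c) X, fun o => by
    cases o with
    | none => exact Or.inr ⟨c, rfl⟩
    | some j => exact Or.inl ⟨j, rfl⟩, rfl⟩

/-- ★ **Slices are cheap**: if `deg_t H ≤ D` and `d ≤ D` then
`L(coeffEps d H) ≤ (D+1)·(L(H)+2) + 1` — root-of-unity interpolation at the `D+1`-st roots of unity.
[folklore] -/
theorem complexity_coeffEps_le (H : MvPolynomial (Option σ) ℂ) {D d : ℕ}
    (hD : H.degreeOf none ≤ D) (hd : d ≤ D) :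
    complexity (coeffEps d H) ≤ (D + 1) * (complexity H + 2) + 1 := by
  set N : ℕ := D + 1 with hNdef
  have hN : N ≠ 0 := by omega
  set ω : ℂ := Complex.exp (2 * Real.pi * Complex.I / N) with hω
  have hprim : IsPrimitiveRoot ω N := Complex.isPrimitiveRoot_exp N hN
  have key := sum_epsEval_rootOfUnity hprim H (show H.degreeOf none < N by omega)
    (show d < N by omega)
  have hNC : ((N : ℕ) : ℂ) ≠ 0 := by exact_mod_cast hN
  have hrepr : coeffEps d H = ((N : ℂ)⁻¹) •
      ∑ i ∈ Finset.range N, C (ω ^ ((N - d) * i)) * epsEval (ω ^ i) H := by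
    rw [key, smul_eq_C_mul, ← mul_assoc, ← C_mul, inv_mul_cancel₀ hNC, C_1, one_mul]
  rw [hrepr]
  refine (complexity_smul_le_holds _ _).trans ?_
  have hsum := complexity_finset_sum_le (Finset.range N)
    (fun i => C (ω ^ ((N - d) * i)) * epsEval (ω ^ i) H)
  rw [Finset.card_range] at hsum
  have hterm : ∀ i, complexity (C (ω ^ ((N - d) * i)) * epsEval (ω ^ i) H) ≤ complexity H + 1 := by
    intro i
    rw [← smul_eq_C_mul]
    exact (complexity_smul_le_holds _ _).trans
      (Nat.add_le_add_right (complexity_epsEval_le (ω ^ i) H) 1)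
  have hsum' : ∑ i ∈ Finset.range N, complexity (C (ω ^ ((N - d) * i)) * epsEval (ω ^ i) H) ≤
      N * (complexity H + 1) := by
    calc ∑ i ∈ Finset.range N, complexity (C (ω ^ ((N - d) * i)) * epsEval (ω ^ i) H)
        ≤ ∑ _i ∈ Finset.range N, (complexity H + 1) := Finset.sum_le_sum fun i _ => hterm i
      _ = N * (complexity H + 1) := by rw [Finset.sum_const, Finset.card_range, smul_eq_mul]
  calc complexity (∑ i ∈ Finset.range N, C (ω ^ ((N - d) * i)) * epsEval (ω ^ i) H) + 1
      ≤ (N * (complexity H + 1) + N) + 1 := by omega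
    _ = (D + 1) * (complexity H + 2) + 1 := by rw [hNdef]; ring

/-- `deg (coeffEps d H) ≤ deg H`. [folklore] -/
theorem totalDegree_coeffEps_le (H : MvPolynomial (Option σ) ℂ) (d : ℕ) :
    (coeffEps d H).totalDegree ≤ H.totalDegree :=
  totalDegree_coeff_optionEquivLeft_le (p := H) (i := d)

/-- `deg_t H ≤ deg H`. [folklore] -/
theorem degreeOf_none_le_totalDegree (H : MvPolynomial (Option σ) ℂ) :
    H.degreeOf none ≤ H.totalDegree :=
  degreeOf_le_totalDegree H none

end CoefficientSlices

end Summit.ValiantsHypothesis.ValiantsHypothesis.Theorems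

end
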